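import Summits.Ventures.PercRepro.MS3Regime

/-!
# The ≤ 1-pair regime of `MSr 3` modulo the general mixed-cell lemma

`MS3Regime.lean` proves `MSr 3` for instances where the type avoiding a colour `i` has at most
one pair, ASSUMING the colour-`i` class has a down-closed difference family — the hypothesis
under which the mixed-cell lemma (TL) is in the kernel (`MSTightTL.lean`). On paper (TL) holds
for EVERY tight family (proofs/MINE1-singlemerge.md §17.5 / §17.8, a corollary of Theorem S, the
characterisation of equality in Marica–Schönheim). This file records that statement as a
CANDIDATE proposition `TLGeneral S` (never asserted) and derives the regime theorem from it with
no further hypothesis (`msr3_card_le_of_small_type_of_TL`): the open Lean piece of the lane is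
exactly `TLGeneral`.
-/

namespace PercRepro

open Finset
open scoped FinsetFamily

variable {S : Type} [Fintype S] [DecidableEq S]

/-- **The general mixed-cell lemma (candidate).** For every tight nonempty family `F` of subsets
of `S` and every `w`: if each member `t` has both agreement cells `t ∩ w`, `wᶜ ∖ t` or both
disagreement cells `t \ w`, `w \ t` among the differences of `F`, then `w` or `wᶜ` is a member.
Paper: Theorem S ⇒ (TL), proofs/MINE1-singlemerge.md §17.5, §17.8. -/
def TLGeneral (S : Type) [Fintype S] [DecidableEq S] : Prop :=
  ∀ (F : Finset (Finset S)) (w : Finset S), MSTight.Tight F → F.Nonempty →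
    (∀ t ∈ F, (t ∩ w ∈ F \\ F ∧ (Finset.univ \ t) ∩ (Finset.univ \ w) ∈ F \\ F) ∨
      (t ∩ (Finset.univ \ w) ∈ F \\ F ∧ (Finset.univ \ t) ∩ w ∈ F \\ F)) →
    w ∈ F ∨ Finset.univ \ w ∈ F

/-- The down-closed case of `TLGeneral` is a theorem (`MSTightTL`). -/
theorem tlGeneral_of_isDownSet {F : Finset (Finset S)} {w : Finset S} (hF : MSTight.Tight F)
    (hne : F.Nonempty) (hD : MSTight.IsDownSet (F \\ F))
    (hcond : ∀ t ∈ F, (t ∩ w ∈ F \\ F ∧ (Finset.univ \ t) ∩ (Finset.univ \ w) ∈ F \\ F) ∨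
      (t ∩ (Finset.univ \ w) ∈ F \\ F ∧ (Finset.univ \ t) ∩ w ∈ F \\ F)) :
    w ∈ F ∨ Finset.univ \ w ∈ F :=
  MSTight.mem_or_sdiff_mem_of_tight_of_isDownSet hF hD (fun _ _ => Finset.subset_univ _) hne
    (Finset.subset_univ _) hcond

/-- **`MSr 3` when some type has at most one pair, modulo `TLGeneral`** — no hypothesis on the
colour classes. -/
theorem msr3_card_le_of_small_type_of_TL (hTL : TLGeneral S) (T : Finset (Config S))
    (κ : Config S → Fin 3) (hT : ∀ A ∈ T, Aᶜ ∈ T) (hκ : ∀ A ∈ T, κ Aᶜ ≠ κ A) (i : Fin 3)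
    (hsmall : (avoidMembers T κ i).card ≤ 2) : T.card ≤ 2 * (classDiffs T κ).card := by
  set C := colourMembers T κ i with hC
  set P := avoidMembers T κ i with hP
  have hcount := card_eq_two_mul_colourMembers_add T κ hT hκ i
  rw [← hC, ← hP] at hcount
  have hsub : C \\ C ⊆ classDiffs T κ := by
    intro E hE
    obtain ⟨A, hA, B, hB, rfl⟩ := Finset.mem_diffs.1 hE
    simp only [hC, colourMembers, Finset.mem_filter] at hA hB
    exact sdiff_mem_classDiffs hA.1 hB.1 (hA.2.trans hB.2.symm)
  have hMS : C.card ≤ (C \\ C).card := Finset.card_le_card_diffs C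
  have hcd : C.card ≤ (classDiffs T κ).card := hMS.trans (Finset.card_le_card hsub)
  by_cases hPe : P = ∅
  · rw [hPe, Finset.card_empty, add_zero] at hcount
    omega
  · obtain ⟨u, hu⟩ := Finset.nonempty_iff_ne_empty.2 hPe
    have huP := hu
    simp only [hP, avoidMembers, Finset.mem_filter] at huP
    obtain ⟨huT, hui, huci⟩ := huP
    have hucP : uᶜ ∈ P := by
      simp only [hP, avoidMembers, Finset.mem_filter]
      exact ⟨hT u huT, huci, by rw [compl_compl]; exact hui⟩
    have hne : u ≠ uᶜ := by
      intro h
      exact hκ u huT (by rw [← h])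
    have hP2 : P.card = 2 := by
      refine le_antisymm hsmall ?_
      have : ({u, uᶜ} : Finset (Config S)) ⊆ P := by
        intro A hA
        rcases Finset.mem_insert.1 hA with rfl | hA
        · exact hu
        · rw [Finset.mem_singleton.1 hA]; exact hucP
      calc 2 = ({u, uᶜ} : Finset (Config S)).card := by rw [Finset.card_pair hne]
        _ ≤ P.card := Finset.card_le_card this
    rw [hP2] at hcount
    by_contra hlt
    have hlt' : 2 * (classDiffs T κ).card < T.card := Nat.lt_of_not_le hlt
    have hcd' : (classDiffs T κ).card ≤ C.card := by omega
    have hCD : C \\ C = classDiffs T κ :=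
      Finset.eq_of_subset_of_card_le hsub (hcd'.trans hMS)
    have htight : (C \\ C).card = C.card := le_antisymm (hCD ▸ hcd') hMS
    set F := C.image toFinset with hF
    have hFtight : MSTight.Tight F := tight_image_toFinset htight
    have hFne : F.Nonempty := by
      by_contra hFe
      rw [Finset.not_nonempty_iff_eq_empty, hF, Finset.image_eq_empty] at hFe
      rw [hFe, Finset.card_empty] at hcount
      have hbot : (⊥ : Config S) ∈ classDiffs T κ := by
        have := sdiff_mem_classDiffs (κ := κ) huT huT rfl
        rwa [sdiff_self] at this
      have : 1 ≤ (classDiffs T κ).card := Finset.card_pos.2 ⟨⊥, hbot⟩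
      omega
    have hdiff : ∀ E : Config S, E ∈ classDiffs T κ → toFinset E ∈ F \\ F := by
      intro E hE
      rw [← hCD] at hE
      rw [hF, ← image_toFinset_diffs]
      exact Finset.mem_image_of_mem _ hE
    have h3 : ∀ a b c d : Fin 3, a ≠ b → c ≠ b → d ≠ b → c ≠ d → a = c ∨ a = d := by decide
    have hcond : ∀ t ∈ F, (t ∩ toFinset u ∈ F \\ F ∧
        (Finset.univ \ t) ∩ (Finset.univ \ toFinset u) ∈ F \\ F) ∨
        (t ∩ (Finset.univ \ toFinset u) ∈ F \\ F ∧ (Finset.univ \ t) ∩ toFinset u ∈ F \\ F) := by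
      intro t ht
      obtain ⟨A, hA, rfl⟩ := Finset.mem_image.1 ht
      have hAC := hA
      simp only [hC, colourMembers, Finset.mem_filter] at hAC
      obtain ⟨hAT, hAi⟩ := hAC
      have hAcT : Aᶜ ∈ T := hT A hAT
      have hAc_ne : κ Aᶜ ≠ i := fun h => hκ A hAT (h.trans hAi.symm)
      rcases h3 (κ Aᶜ) i (κ u) (κ uᶜ) hAc_ne hui huci (fun h => hκ u huT h.symm) with hcol | hcol
      · left
        have e1 : toFinset (u \ Aᶜ) = toFinset A ∩ toFinset u := by
          rw [toFinset_sdiff, toFinset_compl]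
          ext s; simp only [Finset.mem_sdiff, Finset.mem_inter, Finset.mem_univ, true_and, not_not]
          exact and_comm
        have e2 : toFinset (Aᶜ \ u) = (Finset.univ \ toFinset A) ∩ (Finset.univ \ toFinset u) := by
          rw [toFinset_sdiff, toFinset_compl]
          ext s; simp only [Finset.mem_sdiff, Finset.mem_inter, Finset.mem_univ, true_and]
        refine ⟨?_, ?_⟩
        · rw [← e1]; exact hdiff _ (sdiff_mem_classDiffs huT hAcT hcol.symm)
        · rw [← e2]; exact hdiff _ (sdiff_mem_classDiffs hAcT huT hcol)
      · right
        have e1 : toFinset (uᶜ \ Aᶜ) = toFinset A ∩ (Finset.univ \ toFinset u) := by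
          rw [toFinset_sdiff, toFinset_compl, toFinset_compl]
          ext s; simp only [Finset.mem_sdiff, Finset.mem_inter, Finset.mem_univ, true_and, not_not]
          tauto
        have e2 : toFinset (Aᶜ \ uᶜ) = (Finset.univ \ toFinset A) ∩ toFinset u := by
          rw [toFinset_sdiff, toFinset_compl, toFinset_compl]
          ext s; simp only [Finset.mem_sdiff, Finset.mem_inter, Finset.mem_univ, true_and, not_not]
        have hucT : uᶜ ∈ T := hT u huT
        refine ⟨?_, ?_⟩
        · rw [← e1]; exact hdiff _ (sdiff_mem_classDiffs hucT hAcT hcol.symm)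
        · rw [← e2]; exact hdiff _ (sdiff_mem_classDiffs hAcT hucT hcol)
    rcases hTL F (toFinset u) hFtight hFne hcond with hw | hw
    · obtain ⟨A, hA, hAu⟩ := Finset.mem_image.1 hw
      have := toFinset_injective hAu
      subst this
      simp only [hC, colourMembers, Finset.mem_filter] at hA
      exact hui hA.2
    · rw [← toFinset_compl] at hw
      obtain ⟨A, hA, hAu⟩ := Finset.mem_image.1 hw
      have := toFinset_injective hAu
      subst this
      simp only [hC, colourMembers, Finset.mem_filter] at hA
      exact huci hA.2

end PercRepro
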